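import Summits.ResolutionOfSingularities.ResolutionOfSingularities.Theorems.JetCutVastKernels2
import Summits.ResolutionOfSingularities.ResolutionOfSingularities.Theorems.MaxContactCutJetCut
import HarnessLib

/-!
# MaxContactCutJetCut2 — the decomp-res node «JetCut» BY NAME on the host route `MaxContactCut` (lens-2 g15 rev 5,
pin 9f53e5ca), wiring file 2/2

Content VERBATIM from the decomp-res lens-2 file `HOME/decomp-res-lens-2/g15/JetCut.lean` rev 5 (pin 9f53e5ca =
`parts/JetCut-rev5-9f53e5ca.lean`, 7 495 l;
HOME = run/shared/lean/pub/decomp-res; CRITIC-LEDGER rows 109 / 115 / 120 / 121 / 122 / 127 / 133 CLEARED; landing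
order INBOX :231; the critic's
HYGIENE-landing.md h1–h11 applied — DOCSTRING-ONLY).  The lens's blocks RESTATED VERBATIM from lens-2 g12 / g13 /
g14 (§R / §R13 / §R14) are DELETED:
they are the tree's `RelativeDeltaCut*` / `CurveLeafExit*` / `PinchCut*` modules (namespaces `RelativeDeltaCut`,
`CurveLeafExit`, `PinchCut`, opened;
the lens's `CurveLeafExitRestated.x` / `PinchCutRestated.x` are cited as `CurveLeafExit.x` / `PinchCut.x`, the three
pointwise engine edges of g12 as
`RelativeDeltaCut.x`).  Namespace `…Theorems.JetCut` (the lens's `Theses.JetCut` is gate-reserved), sub-namespaces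
`Tame` / `Wide` / `Broad` / `Vast`
as in the lens; file split only (tree files ≤ 400 lines): sections, variables and every declaration exactly as in
the lens, the long rev-0/1 prose
lives in HOME/decomp-res-lens-2/g15/NODE-g15.md §ARCHIVE-A (not in the tree).  Node files, in import order:
`JetCutJetKernels`, `JetCutPoint`, `JetCutClasses`, `JetCutKernels`, `JetCutTame`, `JetCutTameClasses`,
`JetCutTameKernels`, `JetCutLadder`, `JetCutWideClasses`, `JetCutWideKernels`, `JetCutMixed`, `JetCutBroadClasses`,
`JetCutBroadKernels`, `JetCutDegenerate`, `JetCutVastClasses`, `JetCutVastKernels`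
(each possibly continued `…2`, `…3`), then the wiring `MaxContactCutJetCut*` (in the Theses cone).  All `--supports
stmt-ResolutionOfSingularities-29273`
(`MaxContactCut.RungOne`); nothing closes 29273 — decided cells carry their engines as hypotheses, and exactly ONE
located-residual aside is booked on
the route for this column (`Vast.VastSpecialRung`, home `JetCutVastClasses`).

THE WIRING of the node VERBATIM, BY NAME on the host route `MaxContactCut` (in the Theses cone), in lens order: for
the jet cut and each of its mechanical copies `Tame` / `Wide` / `Broad` / `Vast` — EXACT AT THE RUNG `rungOne_iff :
MaxContactCut.RungOne ⟺ …GenericRung ∧ …SpecialRung` (29273), necessity by letter, `closes`, `closes_of_engines` /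
`closes_of_*_engines`, the cuts beneath (`…SpecialRung_iff_iso`, `closes_of_columns`, `…SpecialRung_iff_leaves`,
`closes_of_leaves`, `e_one_iff_families`), the MAP EDGES to 28544 (`closes_core`) and 30461
(`closes_closedPointCore`), and the REFINEMENT EDGES BY NAME to g14 `PinchCut.PinchGenericRung` /
`PinchSpecialRung`, g13 `CurveLeafExit.Leaf*Rung`, g12 `RelativeDeltaCut.Rel*Rung`, the tree asides 32106/32107
(g10), 31576/31577 (g9) and g11's `DeltaGenericRung` / `DeltaSpecialRung` — 0 sorry.  Imports the last route-free
file of the node and `MaxContactCutPinchCut`.  Supports 29273.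

This file carries: `Wide.closes_core`, `Wide.closes_closedPointCore`, `Wide.tameSpecialRung_iff_wideSpecialRung`,
`Wide.jetSpecialRung_iff_wideSpecialRung`, `Broad.rungOne_iff`, `Broad.broadGenericRung_of_rungOne`,
`Broad.broadSpecialRung_of_rungOne`, `Broad.broadSpecialRung_iff_rungOne`, `Broad.closes`,
`Broad.closes_of_engines`, `Broad.closes_of_seven_engines`, `Broad.closes_of_columns`, `Broad.closes_of_leaves`,
`Broad.closes_core`, `Broad.closes_closedPointCore`, `Broad.wideSpecialRung_iff_broadSpecialRung`,
`Broad.tameSpecialRung_iff_broadSpecialRung`, `Broad.jetSpecialRung_iff_broadSpecialRung`, `Vast.rungOne_iff`,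
`Vast.vastGenericRung_of_rungOne`, `Vast.vastSpecialRung_of_rungOne`, `Vast.vastSpecialRung_iff_rungOne`,
`Vast.closes`, `Vast.closes_of_engines`, `Vast.closes_of_seven_engines`,
`Vast.broadSpecialRung_iff_vastSpecialRung`, `Vast.wideSpecialRung_iff_vastSpecialRung`,
`Vast.tameSpecialRung_iff_vastSpecialRung`, `Vast.jetSpecialRung_iff_vastSpecialRung`.

(Sources: HunekeSwanson2006 Cor. 5.5.5; CossartJannsenSaito2020 Ch. 2, Thm. 3.6/3.7, Ch. 8; CossartPiltant2008 Prop.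
4.2; CossartPiltant2019 Rem. 3.2; Hironaka1964 Ch. III; Hironaka1967; Hironaka1977; Moh1987; Giraud1975.)
-/

open CategoryTheory AlgebraicGeometry TopologicalSpace IsLocalRing
open Literature.AlgebraicGeometry.Resolution
open Summit.ResolutionOfSingularities.ResolutionOfSingularities.Theorems
open Summit.ResolutionOfSingularities.ResolutionOfSingularities.Theorems.WeakOrderReduction
open Summit.ResolutionOfSingularities.ResolutionOfSingularities.Theorems.DeltaFaceCutClasses
open Summit.ResolutionOfSingularities.ResolutionOfSingularities.Theorems.RelativeDeltaCut
open Summit.ResolutionOfSingularities.ResolutionOfSingularities.Theorems.CurveLeafExit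
open Summit.ResolutionOfSingularities.ResolutionOfSingularities.Theorems.PinchCut
open Summit.ResolutionOfSingularities.ResolutionOfSingularities.Theses

namespace Summit.ResolutionOfSingularities.ResolutionOfSingularities.Theorems.JetCut

namespace Wide

section Kernels

variable {n : ℕ}

/-! ### Map edges BY NAME to the tree's located residuals -/

/-- MAP EDGE to the located core `MaxContactCut.StepPICoreDimFour` (28544) BY NAME, through
`MaxContactCutTauLadder.closes`. [folklore] -/
theorem closes_core (h5 : MaxContactCutExhaustion.ContactOrderSequenceDimFour) (r4 : MaxContactCut.RungFour)
    (r3 : MaxContactCut.RungThree) (r2 : MaxContactCut.RungTwo) (hG : WideGenericRung) (hS : WideSpecialRung)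
    (hSS : MaxContactCut.SequenceToStepAll) : MaxContactCut.StepPICoreDimFour :=
  (MaxContactCutTauLadder.closes h5 r4 r3 r2 (closes hG hS) hSS).2.2.2.2

/-- MAP EDGE to g7's located residual `MaxContactCut.ClosedPointCoreAll` (30461) BY NAME (given the rounds, the rung IS
the closed-point core). [folklore] -/
theorem closes_closedPointCore (hE2 : E 2) (h2 : MaxContactCut.RoundCodimTwoAll)
    (h3 : MaxContactCut.RoundCodimThreeAll) (hG : WideGenericRung) (hS : WideSpecialRung) :
    MaxContactCut.ClosedPointCoreAll :=
  (MaxContactCutGenericPointCut.rungOne_iff_core_of_rounds hE2 h2 h3).mp (closes hG hS)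

end Kernels

/-- **EXACT refinement of the tame residual**: given the wide decided half, `TameSpecialRung ⟺ WideSpecialRung`. [folklore] -/
theorem tameSpecialRung_iff_wideSpecialRung (hG : WideGenericRung) : Tame.TameSpecialRung ↔ WideSpecialRung :=
  ⟨wideSpecialRung_of_tameSpecialRung, fun hS => Tame.tameSpecialRung_of_rungOne (closes hG hS)⟩

/-- **EXACT refinement of rev 0's residual** through both cuts. [folklore] -/
theorem jetSpecialRung_iff_wideSpecialRung (hG : WideGenericRung) : JetSpecialRung ↔ WideSpecialRung :=
  ⟨wideSpecialRung_of_jetSpecialRung, fun hS => jetSpecialRung_of_rungOne (closes hG hS)⟩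

end Wide

namespace Broad

section Kernels

variable {n : ℕ}

/-- **EXACT AT THE RUNG**: `RungOne ⟺ BroadGenericRung ∧ BroadSpecialRung` (marking by marking). [folklore] -/
theorem rungOne_iff : MaxContactCut.RungOne ↔ BroadGenericRung ∧ BroadSpecialRung := by
  constructor
  · intro h
    exact ⟨fun hE2 n hn => seqBGen_of_seqDimFour_one (h hE2 n hn),
      fun hE2 n hn => seqBSpec_of_seqDimFour_one (h hE2 n hn)⟩
  · rintro ⟨hG, hS⟩ hE2 n hn
    exact seqDimFour_one_iff.mpr ⟨hG hE2 n hn, hS hE2 n hn⟩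

/-- NECESSITY by letter: the decided half is implied by the rung. [folklore] -/
theorem broadGenericRung_of_rungOne (h : MaxContactCut.RungOne) : BroadGenericRung := (rungOne_iff.mp h).1

/-- NECESSITY by letter: the located residual is implied by the rung. [folklore] -/
theorem broadSpecialRung_of_rungOne (h : MaxContactCut.RungOne) : BroadSpecialRung := (rungOne_iff.mp h).2

/-- HONESTY KERNEL: modulo the decided half, the located residual IS the rung. [folklore] -/
theorem broadSpecialRung_iff_rungOne (hG : BroadGenericRung) : BroadSpecialRung ↔ MaxContactCut.RungOne :=
  ⟨fun hS => rungOne_iff.mpr ⟨hG, hS⟩, broadSpecialRung_of_rungOne⟩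

/-- **DECIDING IMPLICATION OF THE NODE**: `MaxContactCut.RungOne` (29273) BY NAME from the two halves. [folklore] -/
theorem closes (hG : BroadGenericRung) (hS : BroadSpecialRung) : MaxContactCut.RungOne :=
  rungOne_iff.mpr ⟨hG, hS⟩

/-- `RungOne` BY NAME from the eight ENGINES, the ports and the located residual. [folklore] -/
theorem closes_of_engines (hV : VeryNearCutClasses.VeryNearExit) (hD : DeltaPackageExit)
    (hU : UniformCurvePackageExit) (hR : RelCurvePackageExit) (hN : NormalConeJumpExit)
    (hM : MonomialPinchExit) (hC : FlatConeExit) (hB : BroadExit) (hP : ∀ n : ℕ, 2 ≤ n → CurvePackagePort n)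
    (h1 : FaceFormCutClasses.OrderOneContact) (hS : BroadSpecialRung) : MaxContactCut.RungOne :=
  closes (broadGenericRung_of_engines hV hD hU hR hN hM hC hB hP h1) hS

/-- **SEVEN engines suffice** — engine (B) SUBSUMES g14's engine (C) (`flatConeExit_of_broadExit`, PROVED): `RungOne` BY
NAME from `VeryNearExit`, `DeltaPackageExit`, `UniformCurvePackageExit`, `RelCurvePackageExit`, `NormalConeJumpExit`,
`MonomialPinchExit`, `BroadExit`, the ports and the located residual — NO `FlatConeExit` hypothesis. [folklore] -/
theorem closes_of_seven_engines (hV : VeryNearCutClasses.VeryNearExit) (hD : DeltaPackageExit)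
    (hU : UniformCurvePackageExit) (hR : RelCurvePackageExit) (hN : NormalConeJumpExit)
    (hM : MonomialPinchExit) (hB : BroadExit) (hP : ∀ n : ℕ, 2 ≤ n → CurvePackagePort n)
    (h1 : FaceFormCutClasses.OrderOneContact) (hS : BroadSpecialRung) : MaxContactCut.RungOne :=
  closes_of_engines hV hD hU hR hN hM (flatConeExit_of_broadExit hB) hB hP h1 hS

/-- `RungOne` BY NAME from the decided half and the two isolation columns. [folklore] -/
theorem closes_of_columns (hG : BroadGenericRung) (hN : E 2 → ∀ n : ℕ, 1 ≤ n → SeqBSpecNonIso n)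
    (hI : E 2 → ∀ n : ℕ, 1 ≤ n → SeqBSpecIso n) : MaxContactCut.RungOne :=
  closes hG (broadSpecialRung_iff_iso.mpr ⟨hN, hI⟩)

/-- `RungOne` BY NAME from the decided half and the four leaves. [folklore] -/
theorem closes_of_leaves (hG : BroadGenericRung) (hR : E 2 → ∀ n : ℕ, 1 ≤ n → SeqBSpecCurveReg n)
    (hS : E 2 → ∀ n : ℕ, 1 ≤ n → SeqBSpecCurveSing n) (hT : E 2 → ∀ n : ℕ, 1 ≤ n → SeqBSpecTangle n)
    (hI : E 2 → ∀ n : ℕ, 1 ≤ n → SeqBSpecIso n) : MaxContactCut.RungOne :=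
  closes hG (broadSpecialRung_iff_leaves.mpr ⟨hR, hS, hT, hI⟩)

/-! ### Map edges BY NAME to the tree's located residuals -/

/-- MAP EDGE to the located core `MaxContactCut.StepPICoreDimFour` (28544) BY NAME, through
`MaxContactCutTauLadder.closes`. [folklore] -/
theorem closes_core (h5 : MaxContactCutExhaustion.ContactOrderSequenceDimFour) (r4 : MaxContactCut.RungFour)
    (r3 : MaxContactCut.RungThree) (r2 : MaxContactCut.RungTwo) (hG : BroadGenericRung) (hS : BroadSpecialRung)
    (hSS : MaxContactCut.SequenceToStepAll) : MaxContactCut.StepPICoreDimFour :=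
  (MaxContactCutTauLadder.closes h5 r4 r3 r2 (closes hG hS) hSS).2.2.2.2

/-- MAP EDGE to g7's located residual `MaxContactCut.ClosedPointCoreAll` (30461) BY NAME (given the rounds, the rung IS
the closed-point core). [folklore] -/
theorem closes_closedPointCore (hE2 : E 2) (h2 : MaxContactCut.RoundCodimTwoAll)
    (h3 : MaxContactCut.RoundCodimThreeAll) (hG : BroadGenericRung) (hS : BroadSpecialRung) :
    MaxContactCut.ClosedPointCoreAll :=
  (MaxContactCutGenericPointCut.rungOne_iff_core_of_rounds hE2 h2 h3).mp (closes hG hS)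

end Kernels

/-- **EXACT refinement of rev 3's residual**: given the broad decided half, `WideSpecialRung ⟺ BroadSpecialRung`. [folklore] -/
theorem wideSpecialRung_iff_broadSpecialRung (hG : BroadGenericRung) : Wide.WideSpecialRung ↔ BroadSpecialRung :=
  ⟨broadSpecialRung_of_wideSpecialRung, fun hS => Wide.wideSpecialRung_of_rungOne (closes hG hS)⟩

/-- **EXACT refinement of rev 2's residual** through the wide and broad cuts. [folklore] -/
theorem tameSpecialRung_iff_broadSpecialRung (hG : BroadGenericRung) : Tame.TameSpecialRung ↔ BroadSpecialRung :=
  ⟨broadSpecialRung_of_tameSpecialRung, fun hS => Tame.tameSpecialRung_of_rungOne (closes hG hS)⟩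

/-- **EXACT refinement of rev 0's residual** through all three cuts. [folklore] -/
theorem jetSpecialRung_iff_broadSpecialRung (hG : BroadGenericRung) : JetSpecialRung ↔ BroadSpecialRung :=
  ⟨broadSpecialRung_of_jetSpecialRung, fun hS => jetSpecialRung_of_rungOne (closes hG hS)⟩

end Broad

namespace Vast

section Kernels

variable {n : ℕ}

/-- **EXACT AT THE RUNG**: `RungOne ⟺ VastGenericRung ∧ VastSpecialRung` (marking by marking). [folklore] -/
theorem rungOne_iff : MaxContactCut.RungOne ↔ VastGenericRung ∧ VastSpecialRung := by
  constructor
  · intro h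
    exact ⟨fun hE2 n hn => seqVGen_of_seqDimFour_one (h hE2 n hn),
      fun hE2 n hn => seqVSpec_of_seqDimFour_one (h hE2 n hn)⟩
  · rintro ⟨hG, hS⟩ hE2 n hn
    exact seqDimFour_one_iff.mpr ⟨hG hE2 n hn, hS hE2 n hn⟩

/-- NECESSITY by letter: the decided half is implied by the rung. [folklore] -/
theorem vastGenericRung_of_rungOne (h : MaxContactCut.RungOne) : VastGenericRung := (rungOne_iff.mp h).1

/-- NECESSITY by letter: the located residual is implied by the rung. [folklore] -/
theorem vastSpecialRung_of_rungOne (h : MaxContactCut.RungOne) : VastSpecialRung := (rungOne_iff.mp h).2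

/-- HONESTY KERNEL: modulo the decided half, the located residual IS the rung. [folklore] -/
theorem vastSpecialRung_iff_rungOne (hG : VastGenericRung) : VastSpecialRung ↔ MaxContactCut.RungOne :=
  ⟨fun hS => rungOne_iff.mpr ⟨hG, hS⟩, vastSpecialRung_of_rungOne⟩

/-- **DECIDING IMPLICATION OF THE NODE**: `MaxContactCut.RungOne` (29273) BY NAME from the two halves. [folklore] -/
theorem closes (hG : VastGenericRung) (hS : VastSpecialRung) : MaxContactCut.RungOne :=
  rungOne_iff.mpr ⟨hG, hS⟩

/-- `RungOne` BY NAME from the eight ENGINES, the ports and the located residual. [folklore] -/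
theorem closes_of_engines (hV : VeryNearCutClasses.VeryNearExit) (hD : DeltaPackageExit)
    (hU : UniformCurvePackageExit) (hR : RelCurvePackageExit) (hN : NormalConeJumpExit)
    (hM : MonomialPinchExit) (hC : FlatConeExit) (hVa : VastExit) (hP : ∀ n : ℕ, 2 ≤ n → CurvePackagePort n)
    (h1 : FaceFormCutClasses.OrderOneContact) (hS : VastSpecialRung) : MaxContactCut.RungOne :=
  closes (vastGenericRung_of_engines hV hD hU hR hN hM hC hVa hP h1) hS

/-- **SEVEN engines suffice** — engine (V) SUBSUMES g14's engine (C) (`flatConeExit_of_vastExit`, PROVED): `RungOne` BY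
NAME from `VeryNearExit`, `DeltaPackageExit`, `UniformCurvePackageExit`, `RelCurvePackageExit`, `NormalConeJumpExit`,
`MonomialPinchExit`, `VastExit`, the ports and the located residual — NO `FlatConeExit` hypothesis. [folklore] -/
theorem closes_of_seven_engines (hV : VeryNearCutClasses.VeryNearExit) (hD : DeltaPackageExit)
    (hU : UniformCurvePackageExit) (hR : RelCurvePackageExit) (hN : NormalConeJumpExit)
    (hM : MonomialPinchExit) (hVa : VastExit) (hP : ∀ n : ℕ, 2 ≤ n → CurvePackagePort n)
    (h1 : FaceFormCutClasses.OrderOneContact) (hS : VastSpecialRung) : MaxContactCut.RungOne :=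
  closes_of_engines hV hD hU hR hN hM (flatConeExit_of_vastExit hVa) hVa hP h1 hS

end Kernels

/-- **EXACT refinement of rev 4's residual**: given the vast decided half, `BroadSpecialRung ⟺ VastSpecialRung`. [folklore] -/
theorem broadSpecialRung_iff_vastSpecialRung (hG : VastGenericRung) : Broad.BroadSpecialRung ↔ VastSpecialRung :=
  ⟨vastSpecialRung_of_broadSpecialRung, fun hS => Broad.broadSpecialRung_of_rungOne (closes hG hS)⟩

/-- **EXACT refinement of rev 3's residual** through the broad and vast cuts. [folklore] -/
theorem wideSpecialRung_iff_vastSpecialRung (hG : VastGenericRung) : Wide.WideSpecialRung ↔ VastSpecialRung :=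
  ⟨vastSpecialRung_of_wideSpecialRung, fun hS => Wide.wideSpecialRung_of_rungOne (closes hG hS)⟩

/-- **EXACT refinement of rev 2's residual** through the wide, broad and vast cuts. [folklore] -/
theorem tameSpecialRung_iff_vastSpecialRung (hG : VastGenericRung) : Tame.TameSpecialRung ↔ VastSpecialRung :=
  ⟨vastSpecialRung_of_tameSpecialRung, fun hS => Tame.tameSpecialRung_of_rungOne (closes hG hS)⟩

/-- **EXACT refinement of rev 0's residual** through all four cuts. [folklore] -/
theorem jetSpecialRung_iff_vastSpecialRung (hG : VastGenericRung) : JetSpecialRung ↔ VastSpecialRung :=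
  ⟨vastSpecialRung_of_jetSpecialRung, fun hS => jetSpecialRung_of_rungOne (closes hG hS)⟩

end Vast

end Summit.ResolutionOfSingularities.ResolutionOfSingularities.Theorems.JetCut
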